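import Mathlib
import Summits.QuantumFields.YangMills.Theorems.SourcedPressureJensenSourcedPressureIncrementGaussSqExpMoment
import Literature.Analysis.OperatorTheory.PositiveSqrtSmooth
import HarnessLib

/-!
# Route `CoarseStiffnessTail`, crux `CappedCoarseStiffnessL` (stmt-QuantumFields-25301) — GAUSSIAN TOOLKIT for the crux's linearised instance
# (1/2): the exponential moment of a SUM OF SQUARES of Gaussian linear functionals, and the Schur test for a nonnegative weight

Prover seat `ym-line-cst-p1` g11 (2026-08-28), `--supports stmt-QuantumFields-25301` (helper; generic Gaussian calculus and finite-sum algebra, no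
lattice objects — consumed by the sibling `CoarseStiffnessTailCappedCoarseStiffnessLGaussianInstance.lean` (2/2), which proves the route's CHEAPEST
FALSIFIER (i) «the Gaussian (lattice-Maxwell) instance of the crux» as a kernel theorem).  The crux stays OPEN; R3 is a RECORD rung, not Clay;
`YM3TorusSU2` and the Yang–Mills mass gap are NOT proved or addressed by anything here.

* §1 ★ `integral_exp_sum_sq_inner_le` / `integral_exp_sum_sq_le_of_variance_le` — for `ξ ∼ stdGaussian E` (finite-dimensional real inner product
  space) and finitely many linear functionals `ℓ_y` with the OPERATOR bound `Var(Σ_y η_y ℓ_y) ≤ κ·|η|²` for all `η`, `0 ≤ κ`, `2κ < 1`: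
  `exp(Σ_y ℓ_y(ξ)²)` is integrable and `∫ exp(Σ_y ℓ_y(ξ)²) d stdGaussian ≤ exp(Σ_y Var(ℓ_y) / (1 − 2κ))` — TRACE over one minus twice the operator norm.
  Proof: diagonalise `T = Σ_y ⟨w_y, ·⟩ w_y` (Riesz vectors) in an orthonormal eigenbasis (`LinearMap.IsSymmetric.eigenvectorBasis`), rotate the standard
  Gaussian (`stdGaussian_eq_map_pi_orthonormalBasis`), Fubini (`integral_fintype_prod_eq_prod`), the χ² mgf `∫ e^{λx²} dN(0,1) = (1 − 2λ)^{−1/2}` (tree: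
  `Cruxes.SourcedPressureIncrement.Birth.integral_exp_mul_sq_gaussianReal`) and `(1 − 2λ)^{−1/2} ≤ e^{λ/(1−2κ)}`; the eigenvalue bound `λ_i ≤ κ` is
  `λ_i² = ‖T b_i‖² ≤ κ·Σ_y⟨w_y, b_i⟩² = κλ_i`, the trace is `Σ_i λ_i = Σ_y ‖w_y‖²` (Parseval).  Tree sibling in COORDINATE form (law
  `multivariateGaussian 0 S`, regime `4tΛ ≤ 1`, constant `e^{2t·tr S}`): `SourcedPressureJensen…GaussSqExpMoment.integral_exp_mul_sum_sq_multivariateGaussian_le`;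
  the functional form here needs no identification of the law of `(ℓ_y)_y` and covers the whole range `2κ < 1`.
* §2 `sum_sq_sum_mul_weight_le`, `sum_weight_sq_le'` — Schur test: a weight `V ≥ 0` with row sums `R` and column sums `≤ B` has `|Vᵀη|² ≤ B·R·|η|²`
  and `Σ_p V_{yp}² ≤ B·R` (operator norm of `VVᵀ` at most `B·R`, while its trace is `#rows·B·R` at most).

All [folklore]; references: S. Janson, Gaussian Hilbert Spaces (1997), Ch. 1; R. Vershynin, in Eldar–Kutyniok (eds.), Compressed Sensing (2012), Ch. 5.
-/

set_option autoImplicit false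

noncomputable section

namespace Summit.QuantumFields.YangMills.Theorems.CoarseStiffnessTailGaussianSumSq

open scoped BigOperators RealInnerProductSpace
open MeasureTheory ProbabilityTheory Real

/-! ## §1 The exponential moment of a sum of squares of Gaussian linear functionals (folklore) -/

section Abstract

variable {E : Type*} [NormedAddCommGroup E] [InnerProductSpace ℝ E] [FiniteDimensional ℝ E] [MeasurableSpace E] [BorelSpace E]

/-- **One dimension**: `∫ e^{a x²} dN(0,1)(x) = (1 − 2a)^{−1/2}` for `2a < 1` — the tree's χ² moment generating function
(`Cruxes.SourcedPressureIncrement.Birth.integral_exp_mul_sq_gaussianReal`, route `SourcedPressureJensen`) in the form used below. [folklore] -/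
theorem integral_exp_mul_sq_gaussianReal_eq_inv_sqrt {a : ℝ} (ha : 2 * a < 1) :
    ∫ x, rexp (a * x ^ 2) ∂gaussianReal 0 1 = (√(1 - 2 * a))⁻¹ := by
  rw [(Summit.QuantumFields.YangMills.Cruxes.SourcedPressureIncrement.Birth.integral_exp_mul_sq_gaussianReal
    (show a < 1 / 2 by linarith)).2, one_div, Real.sqrt_inv]

/-- **The scalar bound** `(1 − 2t)^{−1/2} ≤ e^{t/(1 − 2κ)}` for `0 ≤ t ≤ κ`, `2κ < 1` (from `1 + u ≤ e^u` at `u = 2t/(1−2t)`: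
`e^{2t/(1−2t)} ≥ 1/(1−2t)`). [folklore] -/
theorem inv_sqrt_one_sub_le_exp {t κ : ℝ} (ht0 : 0 ≤ t) (htκ : t ≤ κ) (hκ : 2 * κ < 1) :
    (√(1 - 2 * t))⁻¹ ≤ rexp (t / (1 - 2 * κ)) := by
  have hu : 0 < 1 - 2 * t := by linarith
  have hk : 0 < 1 - 2 * κ := by linarith
  -- `(1 − 2t)⁻¹ ≤ e^{2t/(1−2t)}`
  have h1 : (1 - 2 * t)⁻¹ ≤ rexp (t / (1 - 2 * t)) ^ 2 := by
    rw [← Real.exp_nat_mul]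
    have h := Real.add_one_le_exp ((2 : ℕ) * (t / (1 - 2 * t)))
    have heq : ((2 : ℕ) : ℝ) * (t / (1 - 2 * t)) + 1 = (1 - 2 * t)⁻¹ := by
      push_cast
      field_simp
      ring
    rwa [heq] at h
  have h2 : (√(1 - 2 * t))⁻¹ ≤ rexp (t / (1 - 2 * t)) := by
    rw [← Real.sqrt_inv]
    calc √((1 - 2 * t)⁻¹) ≤ √(rexp (t / (1 - 2 * t)) ^ 2) := Real.sqrt_le_sqrt h1
      _ = rexp (t / (1 - 2 * t)) := Real.sqrt_sq (Real.exp_nonneg _)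
  refine h2.trans (Real.exp_le_exp.2 ?_)
  exact div_le_div_of_nonneg_left ht0 hk (by linarith)

/-- **Product formula in diagonal form**: if `Σ_y ⟨w_y, ξ⟩² = Σ_i λ_i ⟨b_i, ξ⟩²` for an orthonormal basis `b` indexed by `Fin (finrank E)` and
`2λ_i < 1` for all `i`, then `∫ exp(Σ_y ⟨w_y, ξ⟩²) d stdGaussian(ξ) = Π_i (1 − 2λ_i)^{−1/2}` (rotation invariance of the standard Gaussian and
Fubini). [folklore] -/
theorem integral_exp_sum_sq_inner_eq_prod {Y : Type*} [Fintype Y] (w : Y → E) {n : ℕ} (b : OrthonormalBasis (Fin n) ℝ E) (lam : Fin n → ℝ)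
    (hdiag : ∀ ξ : E, ∑ y, ⟪w y, ξ⟫ ^ 2 = ∑ i, lam i * ⟪b i, ξ⟫ ^ 2) (hlam : ∀ i, 2 * lam i < 1) :
    ∫ ξ, rexp (∑ y, ⟪w y, ξ⟫ ^ 2) ∂stdGaussian E = ∏ i, (√(1 - 2 * lam i))⁻¹ := by
  rw [stdGaussian_eq_map_pi_orthonormalBasis b,
    integral_map (Measurable.aemeasurable (by fun_prop)) (Continuous.aestronglyMeasurable (by fun_prop))]
  have hpt : ∀ x : Fin n → ℝ, rexp (∑ y, ⟪w y, ∑ j, x j • b j⟫ ^ 2) = ∏ i, rexp (lam i * x i ^ 2) := by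
    intro x
    rw [hdiag, ← Real.exp_sum]
    simp_rw [Literature.Analysis.OperatorTheory.inner_basis_sum_smul b x]
  simp_rw [hpt]
  rw [integral_fintype_prod_eq_prod (f := fun i (t : ℝ) => rexp (lam i * t ^ 2))]
  exact Finset.prod_congr rfl fun i _ => integral_exp_mul_sq_gaussianReal_eq_inv_sqrt (hlam i)

/-- The variance of `ξ ↦ ⟨w, ξ⟩` under the standard Gaussian is `‖w‖²`. [folklore] -/
theorem variance_inner_stdGaussian (w : E) : Var[fun ξ => ⟪w, ξ⟫; stdGaussian E] = ‖w‖ ^ 2 := by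
  have hfun : (fun ξ : E => ⟪w, ξ⟫) = ⇑(innerSL ℝ w) := by
    funext ξ
    simp [innerSL_apply_apply]
  rw [hfun, variance_dual_stdGaussian, innerSL_apply_norm]

/-- **★ THE EXPONENTIAL MOMENT OF A SUM OF SQUARES OF GAUSSIAN LINEAR FUNCTIONALS (Riesz form)**: for `ξ ∼ stdGaussian E`, vectors `w_y`
with the operator bound `‖Σ_y η_y w_y‖² ≤ κ·Σ_y η_y²` for every `η` (i.e. `‖WWᵀ‖ ≤ κ` for the synthesis map), `0 ≤ κ`, `2κ < 1`:
`∫ exp(Σ_y ⟨w_y, ξ⟩²) d stdGaussian(ξ) ≤ exp(Σ_y ‖w_y‖² / (1 − 2κ))` — trace over one minus twice the operator norm.  Proof: diagonalise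
`T = Σ_y ⟨w_y, ·⟩ w_y`, whose eigenvalues are in `[0, κ]` and sum to `Σ_y ‖w_y‖²`.  (Tree sibling in COORDINATE form, regime `4tΛ ≤ 1`,
constant `e^{2t·tr S}`: `SourcedPressureJensen…GaussSqExpMoment.integral_exp_mul_sum_sq_multivariateGaussian_le`; the functional form here needs no
identification of the law of `(ℓ_y)_y` with a `multivariateGaussian` and covers the whole range `2κ < 1`.) [folklore] -/
theorem integral_exp_sum_sq_inner_le {Y : Type*} [Fintype Y] (w : Y → E) {κ : ℝ} (hκ0 : 0 ≤ κ) (hκ : 2 * κ < 1)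
    (hop : ∀ η : Y → ℝ, ‖∑ y, η y • w y‖ ^ 2 ≤ κ * ∑ y, η y ^ 2) :
    Integrable (fun ξ => rexp (∑ y, ⟪w y, ξ⟫ ^ 2)) (stdGaussian E) ∧
      ∫ ξ, rexp (∑ y, ⟪w y, ξ⟫ ^ 2) ∂stdGaussian E ≤ rexp ((∑ y, ‖w y‖ ^ 2) / (1 - 2 * κ)) := by
  classical
  -- the symmetric operator `T ξ = Σ_y ⟨w_y, ξ⟩ • w_y`
  set T : E →ₗ[ℝ] E := ∑ y, (innerₛₗ ℝ (w y)).smulRight (w y) with hTdef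
  have hT_apply : ∀ ξ, T ξ = ∑ y, ⟪w y, ξ⟫ • w y := by
    intro ξ
    simp [hTdef, LinearMap.sum_apply, LinearMap.smulRight_apply]
  have hT : T.IsSymmetric := by
    intro x z
    simp_rw [hT_apply, sum_inner, inner_sum, real_inner_smul_left, real_inner_smul_right]
    refine Finset.sum_congr rfl fun y _ => ?_
    rw [real_inner_comm (w y) x]
    ring
  have hquad : ∀ ξ, ∑ y, ⟪w y, ξ⟫ ^ 2 = ⟪ξ, T ξ⟫ := by
    intro ξ
    simp_rw [hT_apply, inner_sum, real_inner_smul_right, real_inner_comm ξ, sq]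
  -- its orthonormal eigenbasis
  set n : ℕ := Module.finrank ℝ E with hn'
  have hn : Module.finrank ℝ E = n := rfl
  set b : OrthonormalBasis (Fin n) ℝ E := hT.eigenvectorBasis hn with hbdef
  set lam : Fin n → ℝ := hT.eigenvalues hn with hlamdef
  have hTb : ∀ i, T (b i) = lam i • b i := fun i => hT.apply_eigenvectorBasis hn i
  have hnorm : ∀ i, ‖b i‖ = 1 := fun i => b.orthonormal.1 i
  -- diagonal form of the quadratic form
  have hdiag : ∀ ξ : E, ∑ y, ⟪w y, ξ⟫ ^ 2 = ∑ i, lam i * ⟪b i, ξ⟫ ^ 2 := by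
    intro ξ
    rw [hquad, ← b.sum_inner_mul_inner ξ (T ξ)]
    refine Finset.sum_congr rfl fun i _ => ?_
    rw [← hT (b i) ξ, hTb, real_inner_smul_left, real_inner_comm ξ (b i)]
    ring
  -- the eigenvalues: `λ_i = Σ_y ⟨w_y, b_i⟩²`, `T b_i = Σ_y ⟨w_y, b_i⟩ • w_y`
  have hlam_eq : ∀ i, lam i = ∑ y, ⟪w y, b i⟫ ^ 2 := by
    intro i
    have h := hquad (b i)
    rw [hTb, real_inner_smul_right, real_inner_self_eq_norm_sq, hnorm, one_pow, mul_one] at h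
    exact h.symm
  have hlam0 : ∀ i, 0 ≤ lam i := fun i => (hlam_eq i).symm ▸ Finset.sum_nonneg fun y _ => sq_nonneg _
  have hlamκ : ∀ i, lam i ≤ κ := by
    intro i
    have h1 : ‖∑ y, ⟪w y, b i⟫ • w y‖ ^ 2 = lam i ^ 2 := by
      rw [← hT_apply, hTb, norm_smul, hnorm, mul_one, Real.norm_eq_abs, sq_abs]
    have h2 : lam i ^ 2 ≤ κ * lam i := by rw [← h1, hlam_eq i]; exact (hop _).trans (le_of_eq (by rw [← hlam_eq]))
    by_cases hli : lam i = 0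
    · rw [hli]; exact hκ0
    · exact le_of_mul_le_mul_right (by nlinarith [h2]) (lt_of_le_of_ne (hlam0 i) (Ne.symm hli))
  have hlam : ∀ i, 2 * lam i < 1 := fun i => by linarith [hlamκ i]
  -- the trace
  have htrace : ∑ i, lam i = ∑ y, ‖w y‖ ^ 2 := by
    simp_rw [hlam_eq]
    rw [Finset.sum_comm]
    exact Finset.sum_congr rfl fun y _ => b.sum_sq_inner_left (w y)
  -- the product formula and the bound
  have hprod := integral_exp_sum_sq_inner_eq_prod w b lam hdiag hlam
  have hpos : 0 < ∏ i, (√(1 - 2 * lam i))⁻¹ :=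
    Finset.prod_pos fun i _ => inv_pos.2 (Real.sqrt_pos.2 (by linarith [hlam i]))
  refine ⟨?_, ?_⟩
  · by_contra h
    rw [integral_undef h] at hprod
    exact (lt_irrefl (0 : ℝ)) (hprod ▸ hpos)
  · rw [hprod]
    calc ∏ i, (√(1 - 2 * lam i))⁻¹ ≤ ∏ i, rexp (lam i / (1 - 2 * κ)) :=
          Finset.prod_le_prod (fun i _ => (inv_pos.2 (Real.sqrt_pos.2 (by linarith [hlam i]))).le)
            fun i _ => inv_sqrt_one_sub_le_exp (hlam0 i) (hlamκ i) hκ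
      _ = rexp ((∑ y, ‖w y‖ ^ 2) / (1 - 2 * κ)) := by
          rw [← Real.exp_sum, ← Finset.sum_div, htrace]

/-- **★ THE SAME, FOR LINEAR FUNCTIONALS, IN VARIANCE LANGUAGE**: for `ξ ∼ stdGaussian E` and linear functionals `ℓ_y : E →ₗ[ℝ] ℝ` (finitely
many) with `Var(Σ_y η_y ℓ_y) ≤ κ·Σ_y η_y²` for all `η`, `0 ≤ κ`, `2κ < 1`:  `exp(Σ_y ℓ_y(ξ)²)` is integrable and
`∫ exp(Σ_y ℓ_y(ξ)²) d stdGaussian(ξ) ≤ exp(Σ_y Var(ℓ_y) / (1 − 2κ))`.  (Riesz representation + the previous theorem.) [folklore] -/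
theorem integral_exp_sum_sq_le_of_variance_le {Y : Type*} [Fintype Y] (ℓ : Y → E →ₗ[ℝ] ℝ) {κ : ℝ} (hκ0 : 0 ≤ κ) (hκ : 2 * κ < 1)
    (hvar : ∀ η : Y → ℝ, Var[fun ξ => ∑ y, η y * ℓ y ξ; stdGaussian E] ≤ κ * ∑ y, η y ^ 2) :
    Integrable (fun ξ => rexp (∑ y, ℓ y ξ ^ 2)) (stdGaussian E) ∧
      ∫ ξ, rexp (∑ y, ℓ y ξ ^ 2) ∂stdGaussian E ≤ rexp ((∑ y, Var[fun ξ => ℓ y ξ; stdGaussian E]) / (1 - 2 * κ)) := by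
  -- Riesz vectors
  set w : Y → E := fun y => (InnerProductSpace.toDual ℝ E).symm (LinearMap.toContinuousLinearMap (ℓ y)) with hwdef
  have hw : ∀ y ξ, ⟪w y, ξ⟫ = ℓ y ξ := by
    intro y ξ
    rw [hwdef, InnerProductSpace.toDual_symm_apply, LinearMap.coe_toContinuousLinearMap']
  have hlin : ∀ η : Y → ℝ, (fun ξ => ∑ y, η y * ℓ y ξ) = fun ξ => ⟪∑ y, η y • w y, ξ⟫ := by
    intro η; funext ξ
    simp_rw [sum_inner, real_inner_smul_left, hw]
  have hop : ∀ η : Y → ℝ, ‖∑ y, η y • w y‖ ^ 2 ≤ κ * ∑ y, η y ^ 2 := by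
    intro η
    rw [← variance_inner_stdGaussian, ← hlin]
    exact hvar η
  have h := integral_exp_sum_sq_inner_le w hκ0 hκ hop
  simp_rw [hw] at h
  have hv : ∀ y, Var[fun ξ => ℓ y ξ; stdGaussian E] = ‖w y‖ ^ 2 := by
    intro y
    rw [← variance_inner_stdGaussian]
    simp_rw [hw]
  simp_rw [hv]
  exact h

end Abstract

/-! ## §2 The Schur test for a nonnegative weight: operator norm `≤ (row sum)·(column sum)` (folklore) -/

section Schur

variable {α ι : Type*} [Fintype α] [Fintype ι]

/-- **Schur test (transpose form)**: a weight `V ≥ 0` with row sums `R` and column sums `≤ B` has `Σ_p (Σ_y η_y V_{yp})² ≤ B·R·Σ_y η_y²` for every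
`η` — the operator norm of `VVᵀ` is at most `B·R` (weighted Cauchy–Schwarz in `y`, then the two sum rules). [folklore] -/
theorem sum_sq_sum_mul_weight_le (V : α → ι → ℝ) {R B : ℝ} (hV0 : ∀ y p, 0 ≤ V y p) (hrow : ∀ y, ∑ p, V y p = R)
    (hcol : ∀ p, ∑ y, V y p ≤ B) (η : α → ℝ) :
    ∑ p, (∑ y, η y * V y p) ^ 2 ≤ B * R * ∑ y, η y ^ 2 := by
  have hp : ∀ p, (∑ y, η y * V y p) ^ 2 ≤ B * ∑ y, V y p * η y ^ 2 := by
    intro p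
    have hcs : (∑ y, η y * V y p) ^ 2 ≤ (∑ y, V y p) * ∑ y, V y p * η y ^ 2 :=
      Finset.sum_sq_le_sum_mul_sum_of_sq_le_mul Finset.univ (fun y _ => hV0 y p)
        (fun y _ => mul_nonneg (hV0 y p) (sq_nonneg _)) (fun y _ => le_of_eq (by ring))
    exact hcs.trans (mul_le_mul_of_nonneg_right (hcol p) (Finset.sum_nonneg fun y _ => mul_nonneg (hV0 y p) (sq_nonneg _)))
  calc ∑ p, (∑ y, η y * V y p) ^ 2 ≤ ∑ p, B * ∑ y, V y p * η y ^ 2 := Finset.sum_le_sum fun p _ => hp p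
    _ = B * ∑ y, (∑ p, V y p) * η y ^ 2 := by
        rw [← Finset.mul_sum, Finset.sum_comm]
        simp_rw [Finset.sum_mul]
    _ = B * R * ∑ y, η y ^ 2 := by
        simp_rw [hrow]
        rw [← Finset.mul_sum, mul_assoc]

/-- **Hilbert–Schmidt bound per row**: `Σ_p V_{yp}² ≤ B·R` (each entry is `≤ B` by the column bound; cf. `SFWGaussianRung.sum_weight_sq_le`).
[folklore] -/
theorem sum_weight_sq_le' (V : α → ι → ℝ) {R B : ℝ} (hV0 : ∀ y p, 0 ≤ V y p) (hrow : ∀ y, ∑ p, V y p = R)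
    (hcol : ∀ p, ∑ y, V y p ≤ B) (y : α) : ∑ p, V y p ^ 2 ≤ B * R := by
  have hle : ∀ p, V y p ≤ B := fun p =>
    (Finset.single_le_sum (f := fun y' => V y' p) (fun y' _ => hV0 y' p) (Finset.mem_univ y)).trans (hcol p)
  calc ∑ p, V y p ^ 2 = ∑ p, V y p * V y p := Finset.sum_congr rfl fun p _ => sq _
    _ ≤ ∑ p, B * V y p := Finset.sum_le_sum fun p _ => mul_le_mul_of_nonneg_right (hle p) (hV0 y p)
    _ = B * R := by rw [← Finset.mul_sum, hrow]

end Schur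

end Summit.QuantumFields.YangMills.Theorems.CoarseStiffnessTailGaussianSumSq

end
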